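import Literature.Topology.FourManifolds.ComplexProjectiveSpaceOrientationProofs
import Literature.Topology.FourManifolds.IntersectionLatticeOrientationProofs
import Literature.AlgebraicTopology.SingularHomology.OrientationProofs
import Literature.AlgebraicTopology.SingularHomology.PoincareDualityClosed
import Literature.NumberTheory.Transcendental.AnalytificationProjProofs
import Literature.AlgebraicGeometry.Motives.ComplexPointsManifold
import HarnessLib

/-!
# The complex points of `ℙᴺ_ℂ` are an oriented closed `2N`-manifold; Poincaré duality for `ℙᴺ(ℂ)`

Family `hodge`, layer `Literature/AlgebraicGeometry/Motives`. The tree's Gysin / Poincaré-duality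
files on complex points (`HodgeTheory/ComplexGysin`: `OrientationFamily`, "Not here: the complex
orientations"; `Motives/ComplexPointsManifold`: `ComplexPoints.bijective_poincareDualityMap_of`,
conditional on an orientation and on the duality fact) take the orientation `μ_X` of `X(ℂ)` as a
DATUM. This file supplies it, unconditionally, for projective space itself, by assembling PROVED
results of the tree:

* `complexProjectiveSpaceHomeomorph N : ComplexProjectiveSpace N ≃ₜ ℙ ℂ ℂ^{N+1}` — the smooth
  `2N`-manifold `ℂℙᴺ` of `Literature/Topology/FourManifolds/ComplexProjectiveSpace` is a type
  synonym of Mathlib's projectivization and its topology is the same quotient topology as the one of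
  `Literature/NumberTheory/Transcendental/ProjectiveSpace` (definitionally: the identity is a
  homeomorphism);
* `complexPointsProjectiveSpaceHomeomorph N : ℙᴺ_ℂ(ℂ) ≃ₜ ComplexProjectiveSpace N` — composed
  with Serre's comparison `projPoint` (GAGA §2 n°5; the tree's `isHomeomorph_projPoint`);
* `ComplexPoints.homologicalOrientationIntProjectiveSpace N` — **a homological `ℤ`-orientation of
  `ℙᴺ_ℂ(ℂ)` in dimension `2N`**: `ℂℙᴺ` is smoothly orientable (holomorphic atlas,
  `det_ℝ = |det_ℂ|² > 0`; the tree's PROVED `isOrientable_complexProjectiveSpace_holds`,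
  Milnor–Stasheff §14 / Huybrechts Cor. 1.2.3), a smooth orientation of a `C¹` manifold gives a
  homological `ℤ`-orientation (Bredon VI.7 Thm. 7.15, Milnor–Stasheff App. A; the tree's PROVED
  `isOrientableOver_int_of_isOrientable_holds`), transported along the homeomorphism
  (`HomologicalOrientation.comap`);
* `ComplexPoints.isOrientableOver_projectiveSpace R N` — hence `ℙᴺ_ℂ(ℂ)` is `R`-orientable for
  every commutative ring `R` (Hatcher p. 235; the tree's PROVED `HomologicalOrientation.toCoeff`);
* `ComplexPoints.bijective_poincareDualityMap_projectiveSpace` — **Poincaré duality for `ℙᴺ(ℂ)`,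
  `N ≥ 1`, unconditionally**: for every `R`-orientation `μ` and `p + q = 2N`,
  `Hᵖ(ℙᴺ(ℂ); R) → H_q(ℙᴺ(ℂ); R)`, `a ↦ a ⌢ [ℙᴺ(ℂ)]_μ`, is bijective (Hatcher Thm. 3.30, the tree's
  PROVED `bijective_poincareDualityMap_of_one_le` for the compact Hausdorff `2N`-manifold
  `ℙᴺ_ℂ(ℂ)`, `Motives.IsSmoothProjective.chartedSpace`).

Not here: the complex orientation of `X(ℂ)` for a general smooth projective `X` (needs the
holomorphic compatibility of the GAGA charts `ComplexPoints.algebraicChart`), and the value of the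
orientation class (which of the two orientations of the connected `ℙᴺ(ℂ)` is "the complex one" is
irrelevant for duality statements).

## References

* [MilnorStasheff1974] J. Milnor, J. Stasheff, Characteristic Classes (1974), §14 and Appendix A.
* [HatcherAT2002] A. Hatcher, Algebraic Topology (CUP 2002), §3.3 p. 235 and Thm. 3.30.
* [SerreGAGA1956] J.-P. Serre, GAGA, Ann. Inst. Fourier 6 (1956), §2 n°5 Prop. 2.
-/

noncomputable section

open scoped LinearAlgebra.Projectivization Manifold

namespace Literature.AlgebraicGeometry.Motives

open Literature.AlgebraicTopology.SingularHomology Literature.Topology.FourManifolds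
  Literature.NumberTheory.Transcendental

universe v

/-- **`ℂℙᴺ = ℙ(ℂ^{N+1})` as topological spaces**: the smooth manifold `ComplexProjectiveSpace N` of
`Literature/Topology/FourManifolds/ComplexProjectiveSpace` is a type synonym of Mathlib's
`Projectivization ℂ (Fin (N + 1) → ℂ)`, and both files put the quotient topology of
`ℂ^{N+1} ∖ {0}` on it, so the identity is a homeomorphism. [folklore] -/
def complexProjectiveSpaceHomeomorph (N : ℕ) : ComplexProjectiveSpace N ≃ₜ ℙ ℂ (Fin (N + 1) → ℂ) where
  toEquiv := Equiv.refl _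
  continuous_toFun := continuous_id
  continuous_invFun := continuous_id

/-- **`ℙᴺ_ℂ(ℂ) ≃ₜ ℂℙᴺ`**: the complex points of the scheme `ℙᴺ_ℂ` with their analytic topology are
homeomorphic to the manifold `ℂℙᴺ`, through Serre's comparison `projPoint : ℙ(ℂ^{N+1}) → ℙᴺ_ℂ(ℂ)`
(GAGA §2 n°5; the tree's `isHomeomorph_projPoint`). [cite: SerreGAGA1956, §2 n°5 Prop. 2] -/
def complexPointsProjectiveSpaceHomeomorph (N : ℕ) :
    ComplexPoints (projectiveSpace N ℂ) ≃ₜ ComplexProjectiveSpace N :=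
  (isHomeomorph_projPoint N).homeomorph.symm.trans (complexProjectiveSpaceHomeomorph N).symm

/-- **A homological `ℤ`-orientation of `ℙᴺ_ℂ(ℂ)`** (dimension `2N`): the smooth orientation of
`ℂℙᴺ` given by its holomorphic atlas (`isOrientable_complexProjectiveSpace_holds`: complex manifolds
carry a preferred orientation, Milnor–Stasheff §14) induces consistent generators of the local
homology groups `H_{2N}(ℂℙᴺ | x; ℤ)` (Milnor–Stasheff App. A, Bredon VI.7 Thm. 7.15; the tree's
`isOrientableOver_int_of_isOrientable_holds`), transported to `ℙᴺ_ℂ(ℂ)` along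
`complexPointsProjectiveSpaceHomeomorph`. (A choice among the two orientations of the connected
manifold; duality statements do not depend on it.) [cite: MilnorStasheff1974, §14 and Appendix A] -/
def ComplexPoints.homologicalOrientationIntProjectiveSpace (N : ℕ) :
    HomologicalOrientation ℤ (ComplexPoints (projectiveSpace N ℂ)) (2 * N) :=
  (Classical.choice (isOrientableOver_int_of_isOrientable_holds (ComplexProjectiveSpace N)
    (isOrientable_complexProjectiveSpace_holds N))).comap (complexPointsProjectiveSpaceHomeomorph N)

/-- **`ℙᴺ_ℂ(ℂ)` is `R`-orientable for every commutative ring `R`** ("an orientable manifold is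
`R`-orientable for all `R`", Hatcher p. 235: `μₓ ↦ μₓ ⊗ 1`, the tree's
`HomologicalOrientation.toCoeff`). [cite: HatcherAT2002, §3.3 p. 235] -/
theorem ComplexPoints.isOrientableOver_projectiveSpace (R : Type v) [CommRing R] (N : ℕ) :
    IsOrientableOver R (ComplexPoints (projectiveSpace N ℂ)) (2 * N) := by
  have hX : IsSmoothProjective N (projectiveSpace N ℂ) := isSmoothProjective_projectiveSpace_holds ℂ N
  letI := hX.chartedSpace
  haveI := ComplexPoints.t2Space_of_isSmoothProjective hX
  exact ⟨(ComplexPoints.homologicalOrientationIntProjectiveSpace N).toCoeff R⟩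

/-- **Poincaré duality for `ℙᴺ(ℂ)`, unconditionally** (`N ≥ 1`): for every `R`-orientation `μ` of
the complex points of `ℙᴺ_ℂ` and `p + q = 2N`, the duality map `Hᵖ(ℙᴺ(ℂ); R) → H_q(ℙᴺ(ℂ); R)`,
`a ↦ a ⌢ [ℙᴺ(ℂ)]_μ`, is bijective — Hatcher Thm. 3.30 for the compact Hausdorff `2N`-manifold
`ℙᴺ_ℂ(ℂ)` (`IsSmoothProjective.chartedSpace`, GAGA charts), the tree's PROVED
`bijective_poincareDualityMap_of_one_le`. [cite: HatcherAT2002, §3.3 Thm. 3.30] -/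
theorem ComplexPoints.bijective_poincareDualityMap_projectiveSpace {R : Type} [CommRing R] {N : ℕ}
    (hN : 1 ≤ N) (μ : HomologicalOrientation R (ComplexPoints (projectiveSpace N ℂ)) (2 * N))
    {p q : ℕ} (h : p + q = 2 * N) : Function.Bijective (poincareDualityMap μ h) := by
  have hX : IsSmoothProjective N (projectiveSpace N ℂ) := isSmoothProjective_projectiveSpace_holds ℂ N
  letI := hX.chartedSpace
  haveI := ComplexPoints.compactSpace_of_isSmoothProjective hX
  haveI := ComplexPoints.t2Space_of_isSmoothProjective hX
  exact bijective_poincareDualityMap_of_one_le (by omega) μ h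

end Literature.AlgebraicGeometry.Motives
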